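import Summits.BirchSwinnertonDyer.BirchSwinnertonDyer.Theorems.SignedLowerHalvesKobayashiMainConjectureSmallImageSignedMuConjA
import Literature.NumberTheory.EllipticCurves.FineSelmerCongruentCurves
import HarnessLib

/-!
# Route `SignedLowerHalves`, crux `KobayashiMainConjectureSmallImage` (item stmt-BirchSwinnertonDyer-19002),
# line `birth` (skeleton sha16 b1bf5b11c746572b): the registered stub `stub_saturationSmallImage`
# modulo a RESIDUAL statement — finiteness of `Sel₀(ℚ_∞, E[p])` — and modulo Conjecture A of ANY
# congruent partner curve (seat `bsd-line-slh-p3` gen 3, line lead; helper file,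
# `--supports stmt-BirchSwinnertonDyer-19002 --as helper`; theorems only; a leaf on the leaf part 7)

HONEST FRAMING.  CONDITIONAL theorems; nothing is booked; crux 4 stays OPEN (its Eisenstein half
`stub_lowerSmallImage` has no engine in print at image `⊆ N(C_ns)`); BSD is not proved by any of this.
Binders displayed and never discharged: the construction fact
`Kobayashi2003.thm62_63_73_signedColemanKato_zeta` (`hCK`), the published facts Kobayashi Thm. 1.2
(`h12`) / Thm. 4.1 RATIONAL (`h41`) / the period-unit pair (`h5`, `h3`) — exactly as in the lane-B
parts 4–7 of seat `bsd-ssimc-k3-c4x` — and ONE rider, here in two new spellings.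

## What this file adds to part 7 (`…SmallImageSignedMuConjA.lean`)

Part 7 proved the registered saturation stub for every sign modulo Coates–Sujatha's statement (A)
for `(E, p)` («`Sel₀(ℚ_∞, E[p^∞])^∨` finitely generated over `ℤ_p`», the node
`Rank1Residual.FineSelmer.CoatesSujathaConjectureA` instantiated on the domain).  Two facts PROVED in
the tree since then sharpen what that rider IS:

* Lim–Sujatha 2018 §3 (tree, sorry-free: `FineSelmerCoefficientMap.finite_fineSelmerInfty_pTorsion_of_finite_torsion`
  / `…_torsion_of_finite_pTorsion`, `IwasawaModuleFinitePadicInt.exists_fineSelmerDualData_moduleFinite_iff_finite_pTorsion`):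
  for odd `p` and the cyclotomic `κ`, statement (A) for `(E, p)` ⟺ the RESIDUAL fine Selmer group
  `Sel₀(ℚ_∞, E[p])` — the everywhere-locally-trivial classes of `H¹(ℚ_∞, E[p])` — is FINITE
  (§1, `statementA_iff_finite_residualFineSelmer`).  So the saturation rider is a statement about the
  mod-`p` Galois MODULE `E[p]` and the cyclotomic tower alone: datum-free, sign-free, `L`-free,
  and blind to everything about `E` beyond `ρ̄_{E,p}` (and the finite set of bad places, which the
  tree's `fineSelmerInfty` does not need: its local condition is «trivial at EVERY place»).
* Lim–Sujatha 2018 Prop. 3.2 (tree, sorry-free: `LimSujatha2018.prop32_…_torsionIso_holds`):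
  statement (A) transports along any `Γ_ℚ`-isomorphism `E₂[p] ≅ E[p]` (§1, `statementA_of_partner`).
  Hence saturation for `E` ⟸ statement (A) for ANY `ℚ`-curve `E₂` congruent to `E` mod `p` — e.g. a
  CM partner `A` with `A[p] ≅ E[p]` where one exists (the cell's L4-CM window pairs).  For this HALF of
  the crux no period ratio, no unit `c`, no Mazur–Tate congruence and no preprint enter: the `μ`-wall of
  the congruence roads (the non-unit `Ω_E/Ω_g^{can}` case) is absent from the saturation half.

On item 4's domain (`a_p = 0`, `ρ̄_{E,p}` not onto, `p` odd) the tree knows `ρ̄_{E,p} ≅ Ind_K^ℚ χ̄`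
with `p` INERT in the imaginary quadratic shadow field `K` (lane A,
`…SmallImageShadowInert.lean`); by Shapiro, `Sel₀(ℚ_∞, Ind_K^ℚ χ̄) = Sel₀(K·ℚ_∞, χ̄)`, the `χ̄`-part
of the everywhere-split unramified `𝔽_p`-Iwasawa module of `K(χ̄) = K·ℚ(E[p])` over its cyclotomic
`ℤ_p`-extension — classical Iwasawa theory of an abelian extension of `K` at an INERT prime, in the
cyclotomic direction (Rubin 1991's elliptic-unit setting; `μ = 0` there is OPEN in print).  That
translation is recorded in the line card (`Cruxes/…/Lines/birth.md`, gen-3 addendum), not typed here.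

## Contents (theorems only)

* §1 `statementA_iff_finite_residualFineSelmer`, `statementA_of_finite_residualFineSelmer`,
  `statementA_of_partner` — any elliptic `W/ℚ`, odd `p`.
* §2 `kobayashiMainConjecture_of_finite_residualFineSelmer_of_lowerDivisibility`,
  `kobayashiMainConjecture_of_partner_statementA_of_lowerDivisibility` — one curve, any rank, any
  sign: Eisenstein half + rider ⟹ Kobayashi's main conjecture for that sign (through part 7).
* §3 `stub_saturationSmallImage_of_finite_residualFineSelmer`,
  `stub_saturationSmallImage_of_partner_statementA` — the REGISTERED stub verbatim modulo the binders
  and the rider on the domain, in the two spellings.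
* §4 `kobayashiMainConjectureSmallImage_of_lower_of_finite_residualFineSelmer` — crux 4 BY NAME ⟸
  the statement of the registered `stub_lowerSmallImage` + residual finiteness on the domain + binders.

References: [LimSujatha2018] §3 and Prop. 3.2; [CoatesSujatha2005] Conjecture A, Thm. 3.4;
[Kobayashi2003] Thm. 1.2, 4.1, 6.2–6.3, 7.3–7.4; [Kato2004Asterisque] Thm. 12.6, §17.13;
[KuriharaPollack2007] §3.1; tree: parts 1–7 of lane B (`bsd-ssimc-k3-c4x`), `FineSelmerCongruentCurves`,
`FineSelmerCoefficientMapProofs`, `FineSelmerTorsionCoefficientsFiniteProofs`, `IwasawaModuleFinitePadicIntProofs`.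
-/

set_option linter.dupNamespace false
set_option autoImplicit false

noncomputable section

open scoped Classical MatrixGroups ModularForm Polynomial

open CongruenceSubgroup WeierstrassCurve Field
  Literature.NumberTheory.EllipticCurves Literature.NumberTheory.EllipticCurves.ModularForms
  Literature.NumberTheory.EllipticCurves.Rank1Residual
  Literature.NumberTheory.EllipticCurves.Kobayashi2003 Literature.NumberTheory.EllipticCurves.Kato2004
  Literature.NumberTheory.EllipticCurves.GreenbergVatsal2000 ZpExtension
  Literature.NumberTheory.EllipticCurves.IwasawaAlgebra Literature.NumberTheory.EllipticCurves.Module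
  Summit.BirchSwinnertonDyer.Rank1Residual.Supersingular
  Summit.BirchSwinnertonDyer.BirchSwinnertonDyer.Rank1Residual
  Summit.BirchSwinnertonDyer.BirchSwinnertonDyer.Theorems.SmallImageSignedMuTransfer
  Summit.BirchSwinnertonDyer.BirchSwinnertonDyer.Theorems.SmallImageSignedMuDefect

namespace Summit.BirchSwinnertonDyer.BirchSwinnertonDyer.Theorems.SmallImageSaturationResidual

/-! ### §1 Statement (A) ⟺ finiteness of the residual fine Selmer group; transport along `E₂[p] ≅ E[p]` -/

section Residual

variable (W : WeierstrassCurve ℚ) [W.IsElliptic] (p : ℕ) [Fact p.Prime]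

/-- **Coates–Sujatha's statement (A) for `(E, p)` over `ℚ_∞` is the finiteness of the RESIDUAL fine
Selmer group `Sel₀(ℚ_∞, E[p])`** (odd `p`, cyclotomic `κ`): «some Pontryagin-dual datum of
`Sel₀(ℚ_∞, E[p^∞])` is finitely generated over `ℤ_p`» ⟺ «`Sel₀(ℚ_∞, E[p^∞])[p]` is finite»
(Pontryagin duality, `X/pX` finite ⟺ `X` f.g. over `ℤ_p` for a f.g. `Λ`-module) ⟺ «`Sel₀(ℚ_∞, E[p])`
is finite» (Lim–Sujatha §3 / Greenberg LNM 1716 §3: the coefficient map `H¹(ℚ_∞, E[p]) →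
H¹(ℚ_∞, E[p^∞])[p]` is injective with the fine conditions matching up to a finite defect at the
finitely many places of `ℚ_∞` above the bad places and `p`).  All three steps are sorry-free tree
theorems; this declaration only names their composite.  The right-hand side mentions `E` only
through the Galois module `E[p]`.
[cite: LimSujatha2018, §3 (proof of Prop. 3.2)] [cite: CoatesSujatha2005, statement (A) (§3)] -/
theorem statementA_iff_finite_residualFineSelmer (hp : p ≠ 2) (κ : ZpExtension ℚ p)
    (hκ : κ.IsCyclotomic) :
    (∃ (γ : absoluteGaloisGroup ℚ) (Y : W.FineSelmerDualData κ γ),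
        Module.Finite ℤ_[p] (RestrictScalars ℤ_[p] (IwasawaAlgebra p) Y.X)) ↔
      (GreenbergSelmer.fineSelmerInfty (↥(W.geomTorsion (p : ℤ))) κ :
        Set (subgroupH1 κ.kerSubgroup (W.geomTorsion (p : ℤ)))).Finite := by
  obtain ⟨γ₀, hγ₀⟩ : ∃ γ : absoluteGaloisGroup ℚ, κ.IsTopGenerator γ :=
    κ.surjective (Multiplicative.ofAdd 1)
  rw [IwasawaModuleFinitePadicInt.exists_fineSelmerDualData_moduleFinite_iff_finite_pTorsion W κ hγ₀]
  exact ⟨FineSelmerCoefficientMap.finite_fineSelmerInfty_torsion_of_finite_pTorsion W κ,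
    FineSelmerCoefficientMap.finite_fineSelmerInfty_pTorsion_of_finite_torsion W κ hκ hp⟩

/-- **Statement (A) for `(E, p)` from the finiteness of `Sel₀(ℚ_∞, E[p])`** for every cyclotomic
datum `κ` — the direction the saturation stub consumes (odd `p`).
[cite: LimSujatha2018, §3 (proof of Prop. 3.2)] [cite: CoatesSujatha2005, statement (A) (§3)] -/
theorem statementA_of_finite_residualFineSelmer (hp : p ≠ 2)
    (hfin : ∀ (κ : ZpExtension ℚ p), κ.IsCyclotomic →
      (GreenbergSelmer.fineSelmerInfty (↥(W.geomTorsion (p : ℤ))) κ :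
        Set (subgroupH1 κ.kerSubgroup (W.geomTorsion (p : ℤ)))).Finite) :
    ∀ (κ : ZpExtension ℚ p), κ.IsCyclotomic →
      ∃ (γ : absoluteGaloisGroup ℚ) (Y : W.FineSelmerDualData κ γ),
        Module.Finite ℤ_[p] (RestrictScalars ℤ_[p] (IwasawaAlgebra p) Y.X) :=
  fun κ hκ ↦ (statementA_iff_finite_residualFineSelmer W p hp κ hκ).mpr (hfin κ hκ)

/-- **Statement (A) transports along a congruence mod `p`** (Lim–Sujatha 2018 Prop. 3.2, PROVED in
the tree as `LimSujatha2018.prop32_fineSelmerDual_moduleFinite_iff_of_torsionIso_holds`): if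
`E₂[p] ≅ E[p]` as `Γ_ℚ`-modules and statement (A) holds for `(E₂, p)` over every cyclotomic `κ`,
then it holds for `(E, p)`.  `E₂` is ANY elliptic curve over `ℚ` (e.g. a CM partner); odd `p`.
[cite: LimSujatha2018, §3 Prop. 3.2 (arXiv:1603.08640 p. 8; J. Number Theory 187 (2018) 66–91)] -/
theorem statementA_of_partner (hp : p ≠ 2) (W₂ : WeierstrassCurve ℚ) [W₂.IsElliptic]
    (he : ∃ e : geomTorsion W₂ (p : ℤ) ≃+ geomTorsion W (p : ℤ),
      ∀ (σ : absoluteGaloisGroup ℚ) (P : geomTorsion W₂ (p : ℤ)), e (σ • P) = σ • e P)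
    (hA₂ : ∀ (κ : ZpExtension ℚ p), κ.IsCyclotomic →
      ∃ (γ : absoluteGaloisGroup ℚ) (D : W₂.FineSelmerDualData κ γ),
        Module.Finite ℤ_[p] (RestrictScalars ℤ_[p] (IwasawaAlgebra p) D.X)) :
    ∀ (κ : ZpExtension ℚ p), κ.IsCyclotomic →
      ∃ (γ : absoluteGaloisGroup ℚ) (Y : W.FineSelmerDualData κ γ),
        Module.Finite ℤ_[p] (RestrictScalars ℤ_[p] (IwasawaAlgebra p) Y.X) :=
  fun κ hκ ↦
    (LimSujatha2018.prop32_fineSelmerDual_moduleFinite_iff_of_torsionIso_holds W₂ W p hp he κ hκ).mp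
      (hA₂ κ hκ)

end Residual

/-! ### §2 One curve, one sign: Eisenstein half + rider ⟹ Kobayashi's main conjecture -/

section Closers

variable (W : WeierstrassCurve ℚ) [W.IsElliptic] [W.IsGloballyMinimal] (p : ℕ) [Fact p.Prime]

/-- **`lower ⇒ equality` from the finiteness of the residual fine Selmer group.**  Let `p` be an odd
good prime of `E = W` with `a_p = 0`.  Granted BY NAME the construction fact `hCK`, Kobayashi Thm. 1.2
(`h12`), Thm. 4.1 RATIONAL (`h41`) and the period-unit pair (`h5`, `h3`): if `Sel₀(ℚ_∞, E[p])` is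
finite for every cyclotomic datum `κ`, then for EVERY sign `ε` the Eisenstein half
`KobayashiLowerDivisibility W p ε` implies `KobayashiMainConjecture W p ε`.  Proof: §1 turns the
hypothesis into statement (A), and part 7's `kobayashiMainConjecture_of_conjectureA_of_lowerDivisibility`
(`μ(X₀) = 0` ⟹ `μ(X^ε) ≤ μ(L_p^ε)` by part 6's defect inequality ⟹ saturation by part 4) concludes.
ANY image, ANY rank, NO partner, NO `L`-value input.  CONDITIONAL on the displayed binders.
[cite: Kobayashi2003, Thm. 1.2 (p. 2), Thm. 4.1 (p. 8), Thm. 7.3–7.4 (p. 13)]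
[cite: LimSujatha2018, §3] [cite: CoatesSujatha2005, statement (A) (§3)] -/
theorem kobayashiMainConjecture_of_finite_residualFineSelmer_of_lowerDivisibility
    (hCK : thm62_63_73_signedColemanKato_zeta)
    (h12 : Kobayashi2003.thm12_signedSelmerDual_finite_torsion)
    (h41 : Kobayashi2003.thm41_signedCharIdeal_divisibility)
    (h5 : realPeriodRat_eq_unit_mul_plusPeriod) (h3 : realPeriodRat_eq_unit_mul_plusPeriod_three)
    (hp : p ≠ 2) (hgood : W.HasGoodReductionAtPrime p) (hap : W.frobeniusTrace p = 0)
    (hfin : ∀ (κ : ZpExtension ℚ p), κ.IsCyclotomic →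
      (GreenbergSelmer.fineSelmerInfty (↥(W.geomTorsion (p : ℤ))) κ :
        Set (subgroupH1 κ.kerSubgroup (W.geomTorsion (p : ℤ)))).Finite)
    {ε : ℤˣ} (hlow : KobayashiLowerDivisibility W p ε) : KobayashiMainConjecture W p ε :=
  kobayashiMainConjecture_of_conjectureA_of_lowerDivisibility W p hCK h12 h41 h5 h3 hp hgood hap
    (statementA_of_finite_residualFineSelmer W p hp hfin) hlow

/-- **`lower ⇒ equality` from statement (A) of a congruent partner.**  Same setting and binders; if
some elliptic `E₂/ℚ` has `E₂[p] ≅ E[p]` (`Γ_ℚ`-equivariantly) and statement (A) holds for `(E₂, p)`,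
then for every sign the Eisenstein half for `E` implies Kobayashi's main conjecture for `E`.
Proof: §1 `statementA_of_partner` + part 7.  NO period ratio between `E` and `E₂`, NO congruence of
`L`-functions, NO preprint: the `μ`-input crosses the congruence on the FINE Selmer side (Lim–Sujatha),
where it is an invariant of `E[p]`.  CONDITIONAL on the displayed binders.
[cite: LimSujatha2018, §3 Prop. 3.2] [cite: Kobayashi2003, Thm. 1.2 (p. 2), Thm. 4.1 (p. 8), Thm. 7.3–7.4 (p. 13)] -/
theorem kobayashiMainConjecture_of_partner_statementA_of_lowerDivisibility
    (hCK : thm62_63_73_signedColemanKato_zeta)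
    (h12 : Kobayashi2003.thm12_signedSelmerDual_finite_torsion)
    (h41 : Kobayashi2003.thm41_signedCharIdeal_divisibility)
    (h5 : realPeriodRat_eq_unit_mul_plusPeriod) (h3 : realPeriodRat_eq_unit_mul_plusPeriod_three)
    (hp : p ≠ 2) (hgood : W.HasGoodReductionAtPrime p) (hap : W.frobeniusTrace p = 0)
    (W₂ : WeierstrassCurve ℚ) [W₂.IsElliptic]
    (he : ∃ e : geomTorsion W₂ (p : ℤ) ≃+ geomTorsion W (p : ℤ),
      ∀ (σ : absoluteGaloisGroup ℚ) (P : geomTorsion W₂ (p : ℤ)), e (σ • P) = σ • e P)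
    (hA₂ : ∀ (κ : ZpExtension ℚ p), κ.IsCyclotomic →
      ∃ (γ : absoluteGaloisGroup ℚ) (D : W₂.FineSelmerDualData κ γ),
        Module.Finite ℤ_[p] (RestrictScalars ℤ_[p] (IwasawaAlgebra p) D.X))
    {ε : ℤˣ} (hlow : KobayashiLowerDivisibility W p ε) : KobayashiMainConjecture W p ε :=
  kobayashiMainConjecture_of_conjectureA_of_lowerDivisibility W p hCK h12 h41 h5 h3 hp hgood hap
    (statementA_of_partner W p hp W₂ he hA₂) hlow

end Closers

/-! ### §3 The REGISTERED stub `stub_saturationSmallImage` in the two spellings -/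

/-- **The REGISTERED stub `stub_saturationSmallImage` (skeleton `Lines/birth.lean`, sha16
b1bf5b11c746572b; conclusion verbatim) for EVERY sign modulo the binders `hCK`, `h12`, `h41`, `h5`, `h3`
and ONE rider: on item 4's domain (odd good `p`, corner X7, non-CM, `a_p = 0`, `ρ̄_{E,p}` not onto)
the residual fine Selmer group `Sel₀(ℚ_∞, E[p])` is finite for the cyclotomic `κ`.**  The rider is
EQUIVALENT to Coates–Sujatha's statement (A) on the domain (§1) — hence weaker than the one-sign
analytic rider of parts 3–5 and implied by Iwasawa's classical `μ = 0` for `ℚ(E[p])(μ_{p^∞})`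
(Coates–Sujatha Thm. 3.4) — and is a function of the residual representation alone; on this domain
`ρ̄ ≅ Ind_K^ℚ χ̄` with `p` inert in the imaginary quadratic `K` (lane A, `ShadowInert`), so it is a
statement of the Iwasawa theory of `K(χ̄)` at an inert prime (module docstring).  OPEN class-wide;
nothing booked; crux 4 stays OPEN.
[cite: Kobayashi2003, Thm. 1.2 (p. 2), Thm. 4.1 (p. 8), Thm. 6.2–6.3 (p. 11), Thm. 7.3–7.4 (p. 13)]
[cite: LimSujatha2018, §3] [cite: CoatesSujatha2005, statement (A) and Thm. 3.4] -/
theorem stub_saturationSmallImage_of_finite_residualFineSelmer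
    (hCK : thm62_63_73_signedColemanKato_zeta)
    (h12 : Kobayashi2003.thm12_signedSelmerDual_finite_torsion)
    (h41 : Kobayashi2003.thm41_signedCharIdeal_divisibility)
    (h5 : realPeriodRat_eq_unit_mul_plusPeriod) (h3 : realPeriodRat_eq_unit_mul_plusPeriod_three)
    (hfin : ∀ (W : WeierstrassCurve ℚ) [W.IsElliptic] [W.IsGloballyMinimal] (p : ℕ) [Fact p.Prime],
      p ≠ 2 → ClassX7 W p → ¬ W.HasCM → W.frobeniusTrace p = 0 → ¬ Surj W p →
      ∀ (κ : ZpExtension ℚ p), κ.IsCyclotomic →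
        (GreenbergSelmer.fineSelmerInfty (↥(W.geomTorsion (p : ℤ))) κ :
          Set (subgroupH1 κ.kerSubgroup (W.geomTorsion (p : ℤ)))).Finite) :
    ∀ (W : WeierstrassCurve ℚ) [W.IsElliptic] [W.IsGloballyMinimal] (p : ℕ) [Fact p.Prime],
      p ≠ 2 → ClassX7 W p → ¬ W.HasCM → W.frobeniusTrace p = 0 → ¬ Surj W p →
      ∀ ε : ℤˣ, Summit.BirchSwinnertonDyer.Rank1Residual.Supersingular.KobayashiLowerDivisibility W p ε →
        Summit.BirchSwinnertonDyer.Rank1Residual.Supersingular.KobayashiMainConjecture W p ε := by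
  intro W _ _ p _ hp hX hcm hap hs ε hlow
  exact kobayashiMainConjecture_of_finite_residualFineSelmer_of_lowerDivisibility W p hCK h12 h41 h5 h3
    hp hX.1.1 hap (hfin W p hp hX hcm hap hs) hlow

/-- **The REGISTERED stub `stub_saturationSmallImage` for EVERY sign modulo the binders and ONE
rider in PARTNER form: every `(E, p)` of item 4's domain admits SOME elliptic `E₂/ℚ` with `E₂[p] ≅ E[p]`
(`Γ_ℚ`-equivariantly) for which Coates–Sujatha's statement (A) holds at `p`.**  (`E₂ = E` recovers
part 7; `E₂` = a CM curve congruent to `E` mod `p` is the cell's L4-CM window, now WITHOUT the period /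
unit-`c` wall for this half.)  Proof: Lim–Sujatha Prop. 3.2 (tree, proved) + part 7.  OPEN class-wide
(no class-wide partner with known (A)); nothing booked.
[cite: LimSujatha2018, §3 Prop. 3.2] [cite: CoatesSujatha2005, statement (A)]
[cite: Kobayashi2003, Thm. 1.2 (p. 2), Thm. 4.1 (p. 8), Thm. 7.3–7.4 (p. 13)] -/
theorem stub_saturationSmallImage_of_partner_statementA
    (hCK : thm62_63_73_signedColemanKato_zeta)
    (h12 : Kobayashi2003.thm12_signedSelmerDual_finite_torsion)
    (h41 : Kobayashi2003.thm41_signedCharIdeal_divisibility)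
    (h5 : realPeriodRat_eq_unit_mul_plusPeriod) (h3 : realPeriodRat_eq_unit_mul_plusPeriod_three)
    (hpartner : ∀ (W : WeierstrassCurve ℚ) [W.IsElliptic] [W.IsGloballyMinimal] (p : ℕ) [Fact p.Prime],
      p ≠ 2 → ClassX7 W p → ¬ W.HasCM → W.frobeniusTrace p = 0 → ¬ Surj W p →
      ∃ (W₂ : WeierstrassCurve ℚ) (_ : W₂.IsElliptic),
        (∃ e : geomTorsion W₂ (p : ℤ) ≃+ geomTorsion W (p : ℤ),
          ∀ (σ : absoluteGaloisGroup ℚ) (P : geomTorsion W₂ (p : ℤ)), e (σ • P) = σ • e P) ∧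
        ∀ (κ : ZpExtension ℚ p), κ.IsCyclotomic →
          ∃ (γ : absoluteGaloisGroup ℚ) (D : W₂.FineSelmerDualData κ γ),
            Module.Finite ℤ_[p] (RestrictScalars ℤ_[p] (IwasawaAlgebra p) D.X)) :
    ∀ (W : WeierstrassCurve ℚ) [W.IsElliptic] [W.IsGloballyMinimal] (p : ℕ) [Fact p.Prime],
      p ≠ 2 → ClassX7 W p → ¬ W.HasCM → W.frobeniusTrace p = 0 → ¬ Surj W p →
      ∀ ε : ℤˣ, Summit.BirchSwinnertonDyer.Rank1Residual.Supersingular.KobayashiLowerDivisibility W p ε →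
        Summit.BirchSwinnertonDyer.Rank1Residual.Supersingular.KobayashiMainConjecture W p ε := by
  intro W _ _ p _ hp hX hcm hap hs ε hlow
  obtain ⟨W₂, _, he, hA₂⟩ := hpartner W p hp hX hcm hap hs
  exact kobayashiMainConjecture_of_partner_statementA_of_lowerDivisibility W p hCK h12 h41 h5 h3
    hp hX.1.1 hap W₂ he hA₂ hlow

/-! ### §4 Crux 4 BY NAME from its registered Eisenstein stub and residual finiteness on the domain -/

/-- **Crux 4 `KobayashiMainConjectureSmallImage` BY NAME** ⟸ the statement of the registered stub
`stub_lowerSmallImage` (the Eisenstein half at small image — OPEN, engine-less) + finiteness of the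
residual fine Selmer group `Sel₀(ℚ_∞, E[p])` on item 4's domain + the binders `hCK`, `h12`, `h41`,
`h5`, `h3`.  The composition of the line `birth` with its saturation stub replaced by the residual
rider (§3); the analogue of part 7's `kobayashiMainConjectureSmallImage_of_lower_of_conjectureA`.
A conditional bridge, not a closure; nothing booked.
[cite: Kobayashi2003, Thm. 1.2 (p. 2), Thm. 4.1 (p. 8), Thm. 7.4 (p. 13)] [cite: LimSujatha2018, §3]
[cite: CoatesSujatha2005, statement (A)] -/
theorem kobayashiMainConjectureSmallImage_of_lower_of_finite_residualFineSelmer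
    (hCK : thm62_63_73_signedColemanKato_zeta)
    (h12 : Kobayashi2003.thm12_signedSelmerDual_finite_torsion)
    (h41 : Kobayashi2003.thm41_signedCharIdeal_divisibility)
    (h5 : realPeriodRat_eq_unit_mul_plusPeriod) (h3 : realPeriodRat_eq_unit_mul_plusPeriod_three)
    (hlower : ∀ (W : WeierstrassCurve ℚ) [W.IsElliptic] [W.IsGloballyMinimal] (p : ℕ) [Fact p.Prime],
      p ≠ 2 → ClassX7 W p → ¬ W.HasCM → W.frobeniusTrace p = 0 → ¬ Surj W p →
      ∃ ε : ℤˣ, Summit.BirchSwinnertonDyer.Rank1Residual.Supersingular.KobayashiLowerDivisibility W p ε)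
    (hfin : ∀ (W : WeierstrassCurve ℚ) [W.IsElliptic] [W.IsGloballyMinimal] (p : ℕ) [Fact p.Prime],
      p ≠ 2 → ClassX7 W p → ¬ W.HasCM → W.frobeniusTrace p = 0 → ¬ Surj W p →
      ∀ (κ : ZpExtension ℚ p), κ.IsCyclotomic →
        (GreenbergSelmer.fineSelmerInfty (↥(W.geomTorsion (p : ℤ))) κ :
          Set (subgroupH1 κ.kerSubgroup (W.geomTorsion (p : ℤ)))).Finite) :
    Summit.BirchSwinnertonDyer.BirchSwinnertonDyer.Theses.SignedLowerHalves.KobayashiMainConjectureSmallImage :=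
  kobayashiMainConjectureSmallImage_of_lower_of_conjectureA hCK h12 h41 h5 h3 hlower
    fun W _ _ p _ hp hX hcm hap hs ↦
      statementA_of_finite_residualFineSelmer W p hp (hfin W p hp hX hcm hap hs)

end Summit.BirchSwinnertonDyer.BirchSwinnertonDyer.Theorems.SmallImageSaturationResidual

end
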